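import Summits.BirchSwinnertonDyer.BirchSwinnertonDyer.Theses.ThetaPartnerAtTwo
import Summits.BirchSwinnertonDyer.BirchSwinnertonDyer.Theorems.ByReductionTypeAtTwoSupersingularLineEulerChar
import Literature.NumberTheory.EllipticCurves.Kobayashi2003.SignedSelmerModuleFiniteProofs
import HarnessLib

/-!
# Route `ThetaPartnerAtTwo` (TP2), crux K4 `SignedControlAtTwo` (item stmt-BirchSwinnertonDyer-20309):
# REDUCTION of K4 to its second conjunct, and K4 BY NAME from the `a₂ = 0` signed-Euler-characteristic
# stub (2′) of route `ByReductionTypeAtTwo`'s crux `SupersingularRankZeroAtTwo` (item 19097, line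
# `signed_halves_two` v8) — cross-route memo CROSS-ROUTE-TP2-K3K4-v1 §1 / cell ruling RC-138 (1), helper H4
# (seat `bsd-2adic-ss-1x`, the WIDTH-LEVER second prover lane on 19097)

HONEST FRAMING (cells `bsd-2adic` run/shared/lean/pub/bsd-2adic/ and `bsd-wall` …/bsd-wall/bsd-wall-p2/, HUMAN
RULINGS D-0036/D-0054/D-0074): THEOREMS ONLY — no definition, no named fact, no instance, no `sorry`; nothing about
any Selmer group is asserted beyond the displayed binders; closes no item by itself; BSD is NOT proved by any of
this. PARTITION (D-0054): X5@2 good-SUPERSINGULAR, `a₂ = 0` sub-row (208 rank-`0` census classes; TP2's theta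
habitat = 19 of them) × `p = 2` — types-the-object-of (K4 20309 ⟸ 19097's registered stub (2′)
`stub_zeroSignedEulerChar`); bears_on: TP2 K4 (20309) · K4-leaf crux 19097.

## What is proved

* `signedControlAtTwo_conjunct_one` — conjunct (i) of K4 («`X⁺(E/ℚ_∞)` is finitely generated over
  `Λ = ℤ₂⟦T⟧` for every cyclotomic datum») holds for EVERY elliptic curve, at every prime, with no habitat
  hypothesis: it is the tree theorem `Kobayashi2003.SignedSelmerDualData.moduleFinite` (Kobayashi Thm. 1.2,
  finite-generation clause; Nakayama for dual pairs, any `p`, any `K`).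
* `signedControlAtTwo_of_conjunct_two` — hence K4 `SignedControlAtTwo` reduces to its conjunct (ii)
  (B. D. Kim's generator value `g(0) ∼ 2^{v₂ ∏ c_ℓ} · #Sel_{2^∞}(E/ℚ)` at `2`), ∀-closed over the habitat.
* `exists_constantCoeff_eq_unit_mul_of_signedEulerChar` — HELPER H4, PURE `Λ`-ALGEBRA at ANY prime `p`,
  number field `K`, `ℤ_p`-extension with topological generator `γ`, sign `ε` and Pontryagin-dual datum `D` of
  Kobayashi's `S = Sel^ε(E/K_∞)`: if `S^Γ` is finite and `#S^Γ = u · c · #S_Γ` (`u ∈ ℤ_pˣ`, any `c ∈ ℚ_p` —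
  an «Euler characteristic» `#H⁰/#H¹ ∼ c`), then every generator `g` of `char X^ε` has `g(0) = u′ · c`:
  Greenberg's Lemma 4.2 on the dual pair (`g(0) · #S_Γ = u″ · #S^Γ`,
  `IsDualPair.constantCoeff_charGenerator_mul_natCard_endCoinvariants`, torsion being automatic from
  `S^Γ` finite by `isTorsion_of_finite_endInvariants`), then cancel `#S_Γ ≠ 0` in `ℚ_p`. No `p ≠ 2` anywhere.
* `signedControlAtTwo_of_signedEulerCharAtTwo` — **K4 BY NAME from 19097's stub (2′)**: the registered
  statement `stub_zeroSignedEulerChar` of line `signed_halves_two` (B. D. Kim's signed `Γ`-Euler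
  characteristic READ AT `2` on `Sel⁺(E/ℚ_∞)`: `Sel_{2^∞}(E/ℚ)` finite ⇒ `S^Γ` finite and
  `#S^Γ = u · 2^{v₂ ∏ c_ℓ} · #Sel_{2^∞}(E/ℚ) · #S_Γ`), taken VERBATIM as the hypothesis `hEC`, implies
  `SignedControlAtTwo` — via the tree theorem `signedKim_two_of_eulerChar` (lane `bsd-2adic-ss-1` GEN 3,
  `…SupersingularLineEulerChar.lean`) for (ii) and `moduleFinite` for (i). So item 20309 carries NO content
  beyond 19097's stub (2′): where `p = 2` bites (no `Ê(ℚ₂)`-torsion-freeness à la Silverman IV.6.1, the local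
  index at `2`, the `±` condition at the bottom layer) is INSIDE (2′), common to both routes (memo §1, RC-138 (1)).
* `moduleFinite_isTorsion_constantCoeff_ne_zero_of_finite_endInvariants` — H4's second face: `S^Γ` finite
  alone gives `X^ε` finitely generated, torsion, and `g(0) ≠ 0` (any `p`).
* `kimAtTwo_of_signedControlAtTwo` — bookkeeping: at a habitat curve, K4 delivers exactly the pair of binders
  `h12`-finite-generation / `hKim` (stub group (2b)) of the tree's `a₂ = 0` door
  `bsdp_two_of_kobayashiMainConjecture_two_of_frobeniusTrace_eq_zero` — recorded so that neither route
  re-types the other's binder.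

References: [Kobayashi2003] S. Kobayashi, Invent. Math. 152 (2003) 1–36, Thm. 1.2 (p. 2), Thm. 9.3 (p. 26);
[BDKim2013] B. D. Kim, J. Aust. Math. Soc. 95 (2013) 189–200, Thm. 1.1 / Cor. 3.15; [GreenbergLNM1716]
R. Greenberg, LNM 1716 (1999), §4 Lemma 4.2 (p. 102); cross-route memo
run/shared/lean/pub/bsd-wall/bsd-wall-p2/xroute/CROSS-ROUTE-TP2-K3K4-v1.md (sha16 a5ea7e9a17324178) and its kernel
sketch SketchK4i.lean; cell ruling RC-138 (bsd-2adic STATUS 2026-08-27T10:47:20Z).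
-/

set_option autoImplicit false
-- the Theorems namespace of this sub repeats the summit name by design (D-0017 nested layout)
set_option linter.dupNamespace false

noncomputable section

open scoped Classical

open WeierstrassCurve Literature.NumberTheory.EllipticCurves
  Literature.NumberTheory.EllipticCurves.Rank1Residual
  Literature.NumberTheory.EllipticCurves.Kobayashi2003 Literature.NumberTheory.EllipticCurves.IwasawaDual
  ZpExtension Summit.BirchSwinnertonDyer.BirchSwinnertonDyer.Theses.ThetaPartnerAtTwo

namespace Summit.BirchSwinnertonDyer.BirchSwinnertonDyer.Theorems

namespace ThetaPartnerXRoute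

universe u

/-! ## §1 K4 conjunct (i) is a tree theorem; K4 reduces to conjunct (ii) -/

/-- **K4 conjunct (i) for EVERY curve** (no habitat hypothesis, any elliptic `W/ℚ`): for every cyclotomic
`ℤ₂`-extension datum `(κ, γ)` and every Pontryagin-dual datum `D` of `Sel⁺(E/ℚ_∞)`, `X⁺ = D.X` is a finitely
generated `Λ`-module — Kobayashi's Thm. 1.2, finite-generation clause, = the tree theorem
`SignedSelmerDualData.moduleFinite` (cyclotomicity is not even used). [cite: Kobayashi2003, Thm. 1.2 (p. 2)] -/
theorem signedControlAtTwo_conjunct_one (W : WeierstrassCurve ℚ) [W.IsElliptic] :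
    ∀ (κ : ZpExtension ℚ 2) (γ : Field.absoluteGaloisGroup ℚ), κ.IsCyclotomic → κ.IsTopGenerator γ →
      ∀ D : SignedSelmerDualData W κ γ 1, Module.Finite (IwasawaAlgebra 2) D.X :=
  fun _κ _γ _ hγ D => SignedSelmerDualData.moduleFinite hγ D

/-- **K4 `SignedControlAtTwo` from its conjunct (ii) alone** (the ∀-closed generator-value statement at `2`
on the habitat prefix `¬CM, r_an = 0, GoodSS 2, a₂ = 0`): conjunct (i) is `signedControlAtTwo_conjunct_one`.
[cite: Kobayashi2003, Thm. 1.2 (p. 2)] [cite: BDKim2013, Cor. 3.15] -/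
theorem signedControlAtTwo_of_conjunct_two
    (h2 : ∀ (W : WeierstrassCurve ℚ) [W.IsElliptic] [W.IsGloballyMinimal], ¬ W.HasCM → W.analyticRank = 0 →
      GoodSS W 2 → W.frobeniusTrace 2 = 0 →
      ∀ (κ : ZpExtension ℚ 2) (γ : Field.absoluteGaloisGroup ℚ), κ.IsCyclotomic → κ.IsTopGenerator γ →
        ∀ (D : SignedSelmerDualData W κ γ 1) [Module.Finite (IwasawaAlgebra 2) D.X],
          Module.IsTorsion (IwasawaAlgebra 2) D.X → ∀ g : IwasawaAlgebra 2, D.charIdeal = Ideal.span {g} →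
            Finite (W.selmerGroupPInfty 2) →
              ∃ u : ℤ_[2]ˣ, ((PowerSeries.constantCoeff g : ℤ_[2]) : ℚ_[2]) =
                ((u : ℤ_[2]) : ℚ_[2]) * ((2 : ℕ) : ℚ_[2]) ^ (padicValNat 2 W.tamagawaProduct) *
                  (Nat.card (W.selmerGroupPInfty 2) : ℚ_[2])) :
    SignedControlAtTwo :=
  fun W _ _ hcm hr hss ha => ⟨signedControlAtTwo_conjunct_one W, h2 W hcm hr hss ha⟩

/-! ## §2 Helper H4: the generator value from a signed `Γ`-Euler characteristic — pure `Λ`-algebra, any `p` -/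

section H4

variable {K : Type u} [Field K] [NumberField K] (W : WeierstrassCurve K) [W.IsElliptic] {p : ℕ} [Fact p.Prime]
  {κ : ZpExtension K p} {γ : Field.absoluteGaloisGroup K} {ε : ℤˣ}

/-- **H4 — the generator value from the Euler characteristic (any prime `p`, any number field, either sign).**
Let `D` be a Pontryagin-dual datum of Kobayashi's `S = Sel^ε(E/K_∞)` along a `ℤ_p`-extension with topological
generator `γ`, and `char X^ε = (g)`. If `S^Γ = H⁰(Γ, S)` is finite and `#S^Γ = u · c · #S_Γ` in `ℚ_p` for a unit
`u ∈ ℤ_pˣ` and some `c ∈ ℚ_p` (an Euler-characteristic identity `#H⁰(Γ,S)/#H¹(Γ,S) ∼ c`), then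
**`g(0) = u′ · c`** for a unit `u′`: `X^ε` is finitely generated (`moduleFinite`) and torsion
(`isTorsion_of_finite_endInvariants`), Greenberg's Lemma 4.2 on the dual pair gives `g(0) · #S_Γ = u″ · #S^Γ`
with `S_Γ` finite, and `#S_Γ ≠ 0` cancels in `ℚ_p`. No hypothesis on `p`.
[cite: GreenbergLNM1716, §4 Lemma 4.2 (p. 102)] [cite: Kobayashi2003, Thm. 1.2 (p. 2)] -/
theorem exists_constantCoeff_eq_unit_mul_of_signedEulerChar (hγ : κ.IsTopGenerator γ)
    (D : SignedSelmerDualData W κ γ ε) {g : IwasawaAlgebra p} (hg : D.charIdeal = Ideal.span {g})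
    (hfin : Finite (endInvariants (conjSignedSelmerInfty W κ ε γ - 1))) {c : ℚ_[p]}
    (hEC : ∃ u : ℤ_[p]ˣ, (Nat.card (endInvariants (conjSignedSelmerInfty W κ ε γ - 1)) : ℚ_[p]) =
      ((u : ℤ_[p]) : ℚ_[p]) * c * (Nat.card (EndCoinvariants (conjSignedSelmerInfty W κ ε γ - 1)) : ℚ_[p])) :
    ∃ u : ℤ_[p]ˣ, ((PowerSeries.constantCoeff g : ℤ_[p]) : ℚ_[p]) = ((u : ℤ_[p]) : ℚ_[p]) * c := by
  haveI := D.moduleFinite hγ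
  have htor : Module.IsTorsion (IwasawaAlgebra p) D.X := D.isTorsion_of_finite_endInvariants hγ hfin
  have hdp := D.isDualPair hγ
  have hg' : Module.charIdeal (IwasawaAlgebra p) D.X = Ideal.span {g} := hg
  haveI hfinC : Finite (EndCoinvariants (conjSignedSelmerInfty W κ ε γ - 1)) :=
    hdp.finite_endCoinvariants_of_finite htor hfin
  obtain ⟨u', hu'⟩ := hdp.constantCoeff_charGenerator_mul_natCard_endCoinvariants htor g hg' hfin
  obtain ⟨u, hu⟩ := hEC
  have hCpos : 0 < Nat.card (EndCoinvariants (conjSignedSelmerInfty W κ ε γ - 1)) :=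
    Nat.card_pos_iff.2 ⟨⟨0⟩, hfinC⟩
  have hC0 : (Nat.card (EndCoinvariants (conjSignedSelmerInfty W κ ε γ - 1)) : ℚ_[p]) ≠ 0 := by
    exact_mod_cast hCpos.ne'
  have h1 : ((PowerSeries.constantCoeff g : ℤ_[p]) : ℚ_[p]) *
      (Nat.card (EndCoinvariants (conjSignedSelmerInfty W κ ε γ - 1)) : ℚ_[p]) =
      ((u' : ℤ_[p]) : ℚ_[p]) * (Nat.card (endInvariants (conjSignedSelmerInfty W κ ε γ - 1)) : ℚ_[p]) := by
    have h := congrArg ((↑) : ℤ_[p] → ℚ_[p]) hu'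
    simpa only [PadicInt.coe_mul, PadicInt.coe_natCast] using h
  rw [hu] at h1
  refine ⟨u' * u, ?_⟩
  have h2 : ((PowerSeries.constantCoeff g : ℤ_[p]) : ℚ_[p]) =
      ((u' : ℤ_[p]) : ℚ_[p]) * ((u : ℤ_[p]) : ℚ_[p]) * c := by
    apply mul_right_cancel₀ hC0
    rw [h1]
    ring
  rw [h2]
  push_cast
  ring

/-- **H4, second face: `S^Γ` finite alone already gives `X^ε` finitely generated AND torsion with `g(0) ≠ 0`**
(the two «control inputs» of the `a₂ = 0` door short of the exact value) — `moduleFinite`,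
`isTorsion_of_finite_endInvariants`, `order_eq_zero_and_constantCoeff_ne_zero_of_finite_endInvariants`; any `p`.
[cite: GreenbergLNM1716, §4 Lemma 4.2 (p. 102)] [cite: Kobayashi2003, Thm. 1.2 (p. 2)] -/
theorem moduleFinite_isTorsion_constantCoeff_ne_zero_of_finite_endInvariants (hγ : κ.IsTopGenerator γ)
    (D : SignedSelmerDualData W κ γ ε) {g : IwasawaAlgebra p} (hg : D.charIdeal = Ideal.span {g})
    (hfin : Finite (endInvariants (conjSignedSelmerInfty W κ ε γ - 1))) :
    Module.Finite (IwasawaAlgebra p) D.X ∧ Module.IsTorsion (IwasawaAlgebra p) D.X ∧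
      PowerSeries.constantCoeff g ≠ 0 :=
  ⟨D.moduleFinite hγ, D.isTorsion_of_finite_endInvariants hγ hfin,
    (D.order_eq_zero_and_constantCoeff_ne_zero_of_finite_endInvariants hγ hfin hg).2⟩

end H4

/-! ## §3 K4 BY NAME from 19097's stub (2′) `stub_zeroSignedEulerChar` -/

/-- **K4 `SignedControlAtTwo` (item 20309) from the signed `Γ`-Euler characteristic at `2`** — the hypothesis
`hEC` is VERBATIM the registered stub (2′) `stub_zeroSignedEulerChar` of line `signed_halves_two` (v8) on crux
`SupersingularRankZeroAtTwo` (item 19097): on the `a₂ = 0` sub-row, for every cyclotomic datum, `Sel_{2^∞}(E/ℚ)`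
finite ⇒ `Sel⁺(E/ℚ_∞)^Γ` finite and `#S^Γ = u · 2^{v₂ ∏ c_ℓ} · #Sel_{2^∞}(E/ℚ) · #S_Γ` (B. D. Kim Thm. 1.1 /
Cor. 3.15 + Kobayashi Thm. 9.3 at `n = 0`, printed for odd `p`, READ AT `2`). Conjunct (ii) is the tree theorem
`signedKim_two_of_eulerChar hEC` (Greenberg's Lemma 4.2 on the dual pair), conjunct (i) is `moduleFinite`.
Composition certificate: TP2's K4 carries no content beyond 19097's stub (2′) (memo CROSS-ROUTE-TP2-K3K4-v1 §1).
[cite: BDKim2013, Thm. 1.1 and Cor. 3.15 (p. 199)] [cite: Kobayashi2003, Thm. 1.2 and Thm. 9.3]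
[cite: GreenbergLNM1716, §4 Lemma 4.2 (p. 102)] -/
theorem signedControlAtTwo_of_signedEulerCharAtTwo
    (hEC : ∀ (W : WeierstrassCurve ℚ) [W.IsElliptic] [W.IsGloballyMinimal],
        ¬ W.HasCM → W.analyticRank = 0 → GoodSS W 2 → W.frobeniusTrace 2 = 0 →
        ∀ (κ : ZpExtension ℚ 2) (γ : Field.absoluteGaloisGroup ℚ),
          κ.IsCyclotomic → κ.IsTopGenerator γ → Finite (W.selmerGroupPInfty 2) →
          Finite (endInvariants (conjSignedSelmerInfty W κ 1 γ - 1)) ∧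
            ∃ u : ℤ_[2]ˣ, (Nat.card (endInvariants (conjSignedSelmerInfty W κ 1 γ - 1)) : ℚ_[2]) =
              ((u : ℤ_[2]) : ℚ_[2]) * ((2 : ℕ) : ℚ_[2]) ^ (padicValNat 2 W.tamagawaProduct) *
                (Nat.card (W.selmerGroupPInfty 2) : ℚ_[2]) *
                  (Nat.card (EndCoinvariants (conjSignedSelmerInfty W κ 1 γ - 1)) : ℚ_[2])) :
    SignedControlAtTwo :=
  signedControlAtTwo_of_conjunct_two fun W _ _ hcm hr hss ha κ γ hκ hγ D _ htor g hg hSel =>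
    signedKim_two_of_eulerChar hEC W hcm hr hss ha κ γ hκ hγ D htor g hg hSel

/-- **The habitat-free form**: the same implication with the signed Euler characteristic at `2` asked only
where K4 asks (same prefix), routed through H4 (`exists_constantCoeff_eq_unit_mul_of_signedEulerChar`) — so
the `[Module.Finite]`/torsion binders of K4 (ii) are not even needed as inputs (they follow from `S^Γ` finite).
[cite: BDKim2013, Cor. 3.15 (p. 199)] [cite: GreenbergLNM1716, §4 Lemma 4.2 (p. 102)] -/
theorem signedControlAtTwo_of_signedEulerCharAtTwo'
    (hEC : ∀ (W : WeierstrassCurve ℚ) [W.IsElliptic] [W.IsGloballyMinimal],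
        ¬ W.HasCM → W.analyticRank = 0 → GoodSS W 2 → W.frobeniusTrace 2 = 0 →
        ∀ (κ : ZpExtension ℚ 2) (γ : Field.absoluteGaloisGroup ℚ),
          κ.IsCyclotomic → κ.IsTopGenerator γ → Finite (W.selmerGroupPInfty 2) →
          Finite (endInvariants (conjSignedSelmerInfty W κ 1 γ - 1)) ∧
            ∃ u : ℤ_[2]ˣ, (Nat.card (endInvariants (conjSignedSelmerInfty W κ 1 γ - 1)) : ℚ_[2]) =
              ((u : ℤ_[2]) : ℚ_[2]) * ((2 : ℕ) : ℚ_[2]) ^ (padicValNat 2 W.tamagawaProduct) *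
                (Nat.card (W.selmerGroupPInfty 2) : ℚ_[2]) *
                  (Nat.card (EndCoinvariants (conjSignedSelmerInfty W κ 1 γ - 1)) : ℚ_[2])) :
    SignedControlAtTwo := by
  refine signedControlAtTwo_of_conjunct_two fun W _ _ hcm hr hss ha κ γ hκ hγ D _ _ g hg hSel => ?_
  obtain ⟨hfin, u, hu⟩ := hEC W hcm hr hss ha κ γ hκ hγ hSel
  obtain ⟨u', hu'⟩ := exists_constantCoeff_eq_unit_mul_of_signedEulerChar W hγ D hg hfin
    (c := ((2 : ℕ) : ℚ_[2]) ^ (padicValNat 2 W.tamagawaProduct) * (Nat.card (W.selmerGroupPInfty 2) : ℚ_[2]))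
    ⟨u, by rw [hu]; ring⟩
  exact ⟨u', by rw [hu']; ring⟩

/-! ## §4 Bookkeeping: K4 (ii) is the `hKim` binder of the tree's `a₂ = 0` door, restricted to the habitat -/

/-- **K4's conjunct (ii) at a curve `W` of the habitat IS the door binder `hKim`** of
`bsdp_two_of_kobayashiMainConjecture_two_of_frobeniusTrace_eq_zero` / the stub group (2b) of
`supersingularRankZeroAtTwo_of_line_torsion` at `W` (definitional equality of the two displayed statements).
Recorded so that neither route re-types the other's binder. [cite: BDKim2013, Cor. 3.15 (p. 199)] -/
theorem kimAtTwo_of_signedControlAtTwo (h : SignedControlAtTwo) (W : WeierstrassCurve ℚ) [W.IsElliptic]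
    [W.IsGloballyMinimal] (hcm : ¬ W.HasCM) (hr : W.analyticRank = 0) (hss : GoodSS W 2)
    (ha : W.frobeniusTrace 2 = 0) :
    (∀ (κ : ZpExtension ℚ 2) (γ : Field.absoluteGaloisGroup ℚ), κ.IsCyclotomic → κ.IsTopGenerator γ →
      ∀ D : SignedSelmerDualData W κ γ 1, Module.Finite (IwasawaAlgebra 2) D.X) ∧
    (∀ (κ : ZpExtension ℚ 2) (γ : Field.absoluteGaloisGroup ℚ), κ.IsCyclotomic → κ.IsTopGenerator γ →
      ∀ (D : SignedSelmerDualData W κ γ 1) [Module.Finite (IwasawaAlgebra 2) D.X],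
        Module.IsTorsion (IwasawaAlgebra 2) D.X →
      ∀ g : IwasawaAlgebra 2, D.charIdeal = Ideal.span {g} → Finite (W.selmerGroupPInfty 2) →
        ∃ u : ℤ_[2]ˣ, ((PowerSeries.constantCoeff g : ℤ_[2]) : ℚ_[2]) =
          ((u : ℤ_[2]) : ℚ_[2]) * ((2 : ℕ) : ℚ_[2]) ^ (padicValNat 2 W.tamagawaProduct) *
            (Nat.card (W.selmerGroupPInfty 2) : ℚ_[2])) :=
  h W hcm hr hss ha

end ThetaPartnerXRoute

end Summit.BirchSwinnertonDyer.BirchSwinnertonDyer.Theorems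

end
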